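import Summits.Schanuel.Schanuel.Theorems.ZilberEacConicTranscendence
import Summits.Schanuel.Schanuel.Theorems.ZilberEacTranscendenceDensityPole2
import Summits.Schanuel.Schanuel.Theorems.ZilberEacBranchPoleFibrePoints
import Summits.Schanuel.Schanuel.Theorems.ZilberEacSuperellipticConstFibre
import HarnessLib

/-!
# Arbitrary base branches, XLVII: POLYNOMIAL fibres `y₀ = R(x₀)` over the CONICS — dense by
# THEOREM T with two poles

HONEST FRAMING.  Cell `pub-schanuel` (Zilber's Exponential-Algebraic Closedness, case ladder;
host summit Schanuel), seat 2, gen 29.  Over a conic `x₁² = x₀² + p₁x₀ + p₀` (`c = p₀ − p₁²/4 ≠ 0`)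
the exponential points of `{C, y₀ = R(x₀)}` are `x₀ = 1/s_j` with `e^{1/s} = R(1/s)` (the pole-fibre
labels of file XXXI with `k = 1`), `x₁ = x₀ + p₁/2 + η(s)` on the branch of file XLIII, and
`y₁ = e^{x₁} = R(x₀)e^{p₁/2}e^{η(s)} = ψ(s)e^{p₁/2}e^{η(s)}·s^{-deg R}` (`ψ` = the reflected `R`):
a relation with a POLE in the parameter, handled by file XLVI
(`unprojectedDense_of_transcendental_relation_pole₂`).  Its transcendence reduces to file XLIII by
the substitution `y ↦ R(x)·y` (**`conic_exp_relation_transcendental_polyMul`**).  Result: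
**`unprojectedDense_conic_polyFibre_x₀`** — for `P` monic quadratic with simple roots and every
non-constant `R`, `{x₁² − P(x₀) = 0, y₀ = R(x₀)}` has Zariski-dense exponential points.  With file
XXXVII this decides `y₀ = R(x₀)` over `x₁^k = P(x₀)` for EVERY `(k ≥ 2, deg P ≥ 1)`.  Decided
instances of an OPEN question (Mantova–Masser, PLMS 2024 §1 p. 5); EC(3,2) OPEN; NOT Schanuel's
conjecture (neither used nor implied); EAC ⇏ SC.
-/

noncomputable section

open Filter Topology Set Complex Polynomial
open Literature.NumberTheory.Transcendental Literature.ModelTheory.Zilber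
open Literature.ModelTheory.ExponentialFields

set_option linter.dupNamespace false

namespace Summit.Schanuel.Schanuel.Theorems

/-! ## Part A. Transcendence with a polynomial factor -/

/-- **Transcendence of `u ↦ R(1/u)·θ'e^{η(u)}` over `ℂ(1/u)`** (`R ≠ 0`; `η`, `c`, `θ'` as in
`conic_exp_relation_transcendental`): substitute `y ↦ R(x)y`. [folklore] -/
theorem conic_exp_relation_transcendental_polyMul {p₁ c θ' : ℂ} (hc : c ≠ 0) (hθ' : θ' ≠ 0)
    {η : ℂ → ℂ} (hηan : AnalyticAt ℂ η 0) (hη0 : η 0 = 0)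
    (hηQ : ∀ᶠ u in 𝓝 (0 : ℂ), u * η u ^ 2 + (2 + p₁ * u) * η u - c * u = 0)
    (R : ℂ[X]) (hR0 : R ≠ 0) (H : ℂ[X][X]) (hH0 : H ≠ 0) :
    ¬ ∀ᶠ u in 𝓝[≠] (0 : ℂ), (H.map (Polynomial.evalRingHom u⁻¹)).eval
      (R.eval u⁻¹ * (θ' * Complex.exp (η u))) = 0 := by
  intro h
  set H' : ℂ[X][X] := H.comp (Polynomial.C R * Polynomial.X) with hH'
  refine conic_exp_relation_transcendental hc hθ' hηan hη0 hηQ H' ?_ ?_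
  · rw [hH', Ne, Polynomial.comp_eq_zero_iff, not_or]
    refine ⟨hH0, fun h2 => ?_⟩
    have h3 := congrArg (fun q : ℂ[X][X] => q.coeff 1) h2.2
    simp only [Polynomial.coeff_C_mul, Polynomial.coeff_X_one, mul_one, Polynomial.coeff_C_succ,
      Polynomial.mul_coeff_zero, Polynomial.coeff_X_zero, mul_zero] at h3
    exact hR0 h3
  · filter_upwards [h] with u hu
    rw [hH', Polynomial.map_comp, Polynomial.eval_comp]
    simpa using hu

/-! ## Part B. Conics: normal form -/

section Conic

variable (P : Polynomial ℂ)

/-- A monic quadratic with a simple root: `P(x) = x² + p₁x + p₀` with `p₀ − p₁²/4 ≠ 0`.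
[folklore] -/
theorem conic_normalForm (hP : P.Monic) (h2 : P.natDegree = 2) {r : ℂ} (hr : P.IsRoot r)
    (hr1 : P.derivative.eval r ≠ 0) :
    (∀ x : ℂ, P.eval x = x ^ 2 + P.coeff 1 * x + P.coeff 0) ∧
      P.coeff 0 - P.coeff 1 ^ 2 / 4 ≠ 0 := by
  have h2c : P.coeff 2 = 1 := by rw [← h2]; exact hP.coeff_natDegree
  have hPeval : ∀ x : ℂ, P.eval x = x ^ 2 + P.coeff 1 * x + P.coeff 0 := by
    intro x
    rw [Polynomial.eval_eq_sum_range' (show P.natDegree < 3 by omega)]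
    simp only [Finset.sum_range_succ, Finset.sum_range_zero, zero_add, pow_zero, mul_one, pow_one]
    rw [h2c]
    ring
  refine ⟨hPeval, ?_⟩
  have hPr : r ^ 2 + P.coeff 1 * r + P.coeff 0 = 0 := by rw [← hPeval]; exact hr
  have hPr' : 2 * r + P.coeff 1 ≠ 0 := by
    have h : P.derivative.eval r = 2 * r + P.coeff 1 := by
      rw [Polynomial.derivative_eval, Polynomial.sum_over_range' _ _ 3 (by omega)]
      · simp only [Finset.sum_range_succ, Finset.sum_range_zero, zero_add]
        rw [h2c]
        norm_num
        ring
      · intro n; simp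
    rw [← h]; exact hr1
  intro hc0
  have : (2 * r + P.coeff 1) ^ 2 = 0 := by linear_combination 4 * hPr - 4 * hc0
  exact hPr' (pow_eq_zero_iff two_ne_zero |>.1 this)

/-! ## Part C. Polynomial fibres over conics -/

/-- **`y₀ = R(x₀)` over a conic is dense.**  `P` monic of degree `2` with a simple root, `R`
non-constant: `{x₁² − P(x₀) = 0, y₀ = R(x₀)}` has Zariski-dense exponential points.
[cite: MantovaMasser2023, §1 Further remarks, p. 5 (the question, open in general)] (new) -/
theorem unprojectedDense_conic_polyFibre_x₀ (R : Polynomial ℂ) (hR : 1 ≤ R.natDegree)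
    (hP : P.Monic) (h2 : P.natDegree = 2) {r : ℂ} (hr : P.IsRoot r)
    (hr1 : P.derivative.eval r ≠ 0) :
    UnprojectedDense {w : Fin 2 ⊕ Fin 2 → ℂ |
      MvPolynomial.eval ![w (Sum.inl 0), w (Sum.inl 1)]
          (MvPolynomial.X 1 ^ 2 - Polynomial.aeval (MvPolynomial.X 0 : MvPolynomial (Fin 2) ℂ) P) = 0 ∧
      w (Sum.inr 0) = MvPolynomial.eval ![w (Sum.inl 0), w (Sum.inl 1)]
        (Polynomial.aeval (MvPolynomial.X 0 : MvPolynomial (Fin 2) ℂ) R)} := by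
  classical
  obtain ⟨hPeval, hc0⟩ := conic_normalForm P hP h2 hr hr1
  set p₁ : ℂ := P.coeff 1 with hp₁
  set p₀ : ℂ := P.coeff 0 with hp₀
  set c : ℂ := p₀ - p₁ ^ 2 / 4 with hc
  have hR0 : R ≠ 0 := by
    rintro rfl
    simp at hR
  set d : ℕ := R.natDegree with hd
  -- the surface data
  have hirr := irreducible_superellipticMv P (by norm_num : 1 ≤ 2) hr hr1
  have hS := isIrreducibleClosed_curveGraphFibre
    (Polynomial.aeval (MvPolynomial.X 0 : MvPolynomial (Fin 2) ℂ) R) hirr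
  have hdim := zariskiDim_curveGraphFibre
    (Polynomial.aeval (MvPolynomial.X 0 : MvPolynomial (Fin 2) ℂ) R) hirr
  -- the branch `η` of the conic at infinity
  obtain ⟨η, hηan, hη0, hηQ⟩ := exists_conic_branch p₁ c
  -- the reflected `R`: `ψ(s)s^{-d} = R(1/s)`
  set ψ : ℂ → ℂ := fun s => Polynomial.aeval s (R.reflect d) with hψ
  have hψan : AnalyticAt ℂ ψ 0 := analyticAt_id.aeval_polynomial _
  have hψ0 : ψ 0 ≠ 0 := by
    simp only [hψ, Polynomial.coe_aeval_eq_eval, ← Polynomial.coeff_zero_eq_eval_zero,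
      Polynomial.coeff_reflect, Polynomial.revAt_le (Nat.zero_le _), Nat.sub_zero, hd]
    exact Polynomial.leadingCoeff_ne_zero.2 hR0
  have hrefl : ∀ s : ℂ, s ≠ 0 → ψ s * s ^ (-(d : ℤ)) = R.eval s⁻¹ := by
    intro s hs
    haveI : Invertible s⁻¹ := invertibleOfNonzero (inv_ne_zero hs)
    have h := Polynomial.eval₂_reflect_mul_pow (RingHom.id ℂ) s⁻¹ d R le_rfl
    rw [invOf_eq_inv, inv_inv] at h
    simp only [Polynomial.eval₂_id] at h
    rw [hψ]
    simp only [Polynomial.coe_aeval_eq_eval]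
    rw [zpow_neg, zpow_natCast, ← inv_pow]
    exact h
  -- the labels: `e^{1/s_j} = ψ(s_j)s_j^{-d} = R(1/s_j)`
  obtain ⟨N₀, uu, s, ww, W, -, -, -, -, -, -, hs0, hs, hexp⟩ :=
    exists_poleFibre_expPoints (k := 1) le_rfl (-(d : ℤ)) hψan hψ0 (z := 2 * Real.pi * I)
      (by rw [pow_one])
  have hs' : Tendsto s atTop (𝓝[≠] (0 : ℂ)) :=
    tendsto_nhdsWithin_iff.2 ⟨hs, Eventually.of_forall fun j => hs0 j⟩
  obtain ⟨M₀, hM₀⟩ := Filter.eventually_atTop.1 (hs.eventually hηQ)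
  set σ : ℕ → ℂ := fun m => s (M₀ + m) with hσ
  have hσ0 : ∀ m, σ m ≠ 0 := fun m => hs0 _
  have hσt : Tendsto σ atTop (𝓝 0) := hs.comp (tendsto_add_atTop_nat M₀ |>.congr fun m => by omega)
  have hσQ : ∀ m, σ m * η (σ m) ^ 2 + (2 + p₁ * σ m) * η (σ m) - c * σ m = 0 :=
    fun m => hM₀ (M₀ + m) (Nat.le_add_right _ _)
  have hexpσ : ∀ m, Complex.exp ((σ m)⁻¹) = R.eval (σ m)⁻¹ := by
    intro m
    have h := hexp (M₀ + m)
    rw [pow_one] at h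
    rw [hσ]
    simp only
    rw [h, hrefl _ (hs0 _)]
  -- the points
  set θ' : ℂ := Complex.exp (p₁ / 2) with hθ'
  have hθ'0 : θ' ≠ 0 := Complex.exp_ne_zero _
  set pt : ℕ → Fin 2 ⊕ Fin 2 → ℂ := fun m =>
    Sum.elim ![(σ m)⁻¹, (σ m)⁻¹ + p₁ / 2 + η (σ m)]
      ![R.eval (σ m)⁻¹, Complex.exp ((σ m)⁻¹ + p₁ / 2 + η (σ m))] with hpt
  have hptS : ∀ m, pt m ∈ {w : Fin 2 ⊕ Fin 2 → ℂ |
      MvPolynomial.eval ![w (Sum.inl 0), w (Sum.inl 1)]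
          (MvPolynomial.X 1 ^ 2 - Polynomial.aeval (MvPolynomial.X 0 : MvPolynomial (Fin 2) ℂ) P) = 0 ∧
      w (Sum.inr 0) = MvPolynomial.eval ![w (Sum.inl 0), w (Sum.inl 1)]
        (Polynomial.aeval (MvPolynomial.X 0 : MvPolynomial (Fin 2) ℂ) R)} := by
    intro m
    refine ⟨?_, ?_⟩
    · simp only [hpt, Sum.elim_inl, Matrix.cons_val_zero, Matrix.cons_val_one]
      rw [eval_superellipticMv]
      simp only [Matrix.cons_val_zero, Matrix.cons_val_one, hPeval]
      have hx := hσ0 m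
      have h := hσQ m
      have h' : η (σ m) ^ 2 + (2 * (σ m)⁻¹ + p₁) * η (σ m) - c =
          (σ m)⁻¹ * (σ m * η (σ m) ^ 2 + (2 + p₁ * σ m) * η (σ m) - c * σ m) := by
        field_simp
      rw [h, mul_zero, hc] at h'
      linear_combination h'
    · simp [hpt, eval_polynomial_aeval_X]
  have hpΓ : ∀ m, pt m ∈ expGraph ℂ 2 := by
    intro m
    rw [mem_expGraph_iff]
    intro i
    rw [Literature.ModelTheory.ExponentialFields.ExponentialRing.complex_exp_eq]
    fin_cases i
    · simp [hpt, hexpσ m]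
    · simp [hpt]
  have hnorm : Tendsto (fun m => ‖pt m (Sum.inl 0)‖) atTop atTop := by
    have hσ' : Tendsto σ atTop (𝓝[≠] (0 : ℂ)) :=
      tendsto_nhdsWithin_iff.2 ⟨hσt, Eventually.of_forall fun m => hσ0 m⟩
    have h := (tendsto_norm_inv_nhdsNE_zero_atTop (α := ℂ)).comp hσ'
    refine h.congr fun m => ?_
    simp [hpt]
  -- the relation `y₁ = w(σ)σ^{-d}`, `w = ψ·θ'·e^{η}`
  set w : ℂ → ℂ := fun u => ψ u * (θ' * Complex.exp (η u)) with hw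
  have hwan : AnalyticAt ℂ w 0 := hψan.mul (analyticAt_const.mul hηan.cexp)
  have hx : ∀ m, pt m (Sum.inl 0) = (fun _ : ℂ => (1 : ℂ)) (σ m) * (σ m)⁻¹ ^ 1 := by
    intro m; simp [hpt]
  have hy : ∀ m, pt m (Sum.inr 1) = w (σ m) * (σ m)⁻¹ ^ d := by
    intro m
    simp only [hpt, hw, Sum.elim_inr, Matrix.cons_val_one, Matrix.cons_val_fin_one]
    rw [Complex.exp_add, Complex.exp_add, hexpσ m, ← hrefl _ (hσ0 m), hθ', zpow_neg, zpow_natCast,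
      inv_pow]
    ring
  have htr : ∀ H : ℂ[X][X], H ≠ 0 →
      ¬ (∀ᶠ u in 𝓝[≠] (0 : ℂ), (H.map (Polynomial.evalRingHom
        ((fun _ : ℂ => (1 : ℂ)) u * u⁻¹ ^ 1))).eval (w u * u⁻¹ ^ d) = 0) := by
    intro H hH0 hev
    refine conic_exp_relation_transcendental_polyMul hc0 hθ'0 hηan hη0 hηQ R hR0 H hH0 ?_
    filter_upwards [hev, self_mem_nhdsWithin] with u hu (hu0 : u ≠ 0)
    have e1 : (fun _ : ℂ => (1 : ℂ)) u * u⁻¹ ^ 1 = u⁻¹ := by simp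
    have e2 : w u * u⁻¹ ^ d = R.eval u⁻¹ * (θ' * Complex.exp (η u)) := by
      simp only [hw]
      rw [← hrefl u hu0, zpow_neg, zpow_natCast, inv_pow]
      ring
    rw [e1, e2] at hu
    exact hu
  exact unprojectedDense_of_transcendental_relation_pole₂ hS (le_of_eq hdim) 0 1 hptS hpΓ hnorm
    analyticAt_const hwan 1 d hσ0 hσt hx hy htr

end Conic

end Summit.Schanuel.Schanuel.Theorems

end
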